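import Summits.BirchSwinnertonDyer.BirchSwinnertonDyer.Theses.KolyvaginRankRigidityAtTwo
import Summits.BirchSwinnertonDyer.BirchSwinnertonDyer.Theorems.KolyvaginRankRigidityAtTwoChebotarevWindowPrimeAtTwo
import Summits.BirchSwinnertonDyer.BirchSwinnertonDyer.Theorems.KolyvaginRankRigidityAtTwoWalkStepTransfer
import Summits.BirchSwinnertonDyer.BirchSwinnertonDyer.Theorems.KolyvaginRankRigidityAtTwoSwapFromPiecesPrelims
import Summits.BirchSwinnertonDyer.BirchSwinnertonDyer.Theorems.Rank1ResidualJetCompatibleData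
import Summits.BirchSwinnertonDyer.BirchSwinnertonDyer.Theorems.Rank1ResidualJetRingClassFields
import Summits.BirchSwinnertonDyer.BirchSwinnertonDyer.Theorems.ByReductionTypeAtTwoRankOneAtTwoOffBigImageOddLocalEngineEndToEnd
import Literature.NumberTheory.EllipticCurves.Jetchev2008.CoreVertices
import Summits.BirchSwinnertonDyer.BirchSwinnertonDyer.Theorems.KolyvaginRankRigidityAtTwoRegularCoreSupplyAtTwoRegularConductors
import Summits.BirchSwinnertonDyer.BirchSwinnertonDyer.Theorems.KolyvaginRankRigidityAtTwoWalkNearCore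
import Summits.BirchSwinnertonDyer.BirchSwinnertonDyer.Theorems.KolyvaginRankRigidityAtTwoStartFrameOfParity
import Summits.BirchSwinnertonDyer.BirchSwinnertonDyer.Theorems.KolyvaginRankRigidityAtTwoStartFrameNearCoreHolds
import Summits.BirchSwinnertonDyer.BirchSwinnertonDyer.Theorems.GenusKolyvaginAtTwoKolyvaginRelationAtTwo
import Summits.BirchSwinnertonDyer.BirchSwinnertonDyer.Theorems.GenusKolyvaginAtTwoVisiblePairAtTwoKolyvaginClassSign
import Summits.BirchSwinnertonDyer.BirchSwinnertonDyer.Theorems.KolyvaginRankRigidityAtTwoWalkBridge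
import Summits.BirchSwinnertonDyer.BirchSwinnertonDyer.Theorems.KolyvaginRankRigidityAtTwoSwapOfNamedFacts
import Summits.BirchSwinnertonDyer.BirchSwinnertonDyer.Theorems.KolyvaginRankRigidityAtTwoSwapPairingLowerBoundGlobalOfIndex
import Summits.BirchSwinnertonDyer.BirchSwinnertonDyer.Theorems.GenusKolyvaginAtTwoPowDvdShaCardAtTwoRTKolyvaginClassLevels
import Summits.BirchSwinnertonDyer.BirchSwinnertonDyer.Theorems.KolyvaginRankRigidityAtTwoRegularValueEngineTwoLevel
import Summits.BirchSwinnertonDyer.BirchSwinnertonDyer.Theorems.KolyvaginRankRigidityAtTwoSignedRefillSupplyAtTwo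
import Summits.BirchSwinnertonDyer.BirchSwinnertonDyer.Theorems.GenusKolyvaginAtTwoPowDvdShaCardAtTwoRTKolyvaginClassOrder
import Summits.BirchSwinnertonDyer.BirchSwinnertonDyer.Theorems.KolyvaginRoadThreeLevelData
import Summits.BirchSwinnertonDyer.Rank1Residual.X11b.Three.KolyvaginNonvanishing
import Literature.NumberTheory.EllipticCurves.HeegnerPointsOfConductorRationalityProofs
import Literature.NumberTheory.EllipticCurves.RingClassGalOverCyclicProofs
import Summits.BirchSwinnertonDyer.BirchSwinnertonDyer.Theorems.Rank1ResidualJetCompatibleDataDown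
import Summits.BirchSwinnertonDyer.BirchSwinnertonDyer.Theorems.KolyvaginRankRigidityAtTwoShapeCutAtTwo
import Summits.BirchSwinnertonDyer.BirchSwinnertonDyer.Theorems.KolyvaginRankRigidityAtTwoShapeRefillAtTwo
import Summits.BirchSwinnertonDyer.BirchSwinnertonDyer.Theorems.KolyvaginRankRigidityAtTwoOppositeSignReciprocityAtTwo
import Summits.BirchSwinnertonDyer.BirchSwinnertonDyer.Theorems.KolyvaginRankRigidityAtTwoKolyvaginSwapDefs
import Summits.BirchSwinnertonDyer.BirchSwinnertonDyer.Theorems.KolyvaginRankRigidityAtTwoEngineSupplyAtTwo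
import Summits.BirchSwinnertonDyer.BirchSwinnertonDyer.Theorems.KolyvaginRankRigidityAtTwoKolyvaginSwapShapeLemmas
import HarnessLib

/-!
# Crux U1 `KolyvaginBoundedDefectAtTwo` (stmt-BirchSwinnertonDyer-28083), LINE 17 `kolyvagin_swap` v8.x —
# SWα⁗ · SHED A SEED PRIME BY RECIPROCITY, SHAPED (pen bsd-idea-1 v8.1–v8.5 `ShedSeedPrimeShapedAtTwo`, the L→XL hand of the line)
# — THE PEN'S KERNEL COMPOSITION `shedSeedPrimeShapedAtTwo_of` LANDED BY NAME, modulo the print fact P372 only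

Width seat `bsd-line-krr2-p2` g19 (ONE READER on LINE 17); `--supports stmt-BirchSwinnertonDyer-28083` (helper).  Text of the proof = the pen
`bsd-idea-1` g15's `line17/SWalphaSplit.lean` (sha16 7a3a1bbc3f455963) / `line17/kolyvagin_swap_v85_UNCHECKED.lean` l.895–1131 (sha16
1a50902741cceb1e), VERBATIM except: the five Prop-hypotheses ES/SC/SRF/OSR/SRS are fed by the TREE theorems
`RegularWalk.engineSupplyAtTwo` (ES, C = 4), `RegularWalk.shapeCutAtTwo` (SC, p729679), `RegularWalk.shapeRefillAtTwo` (SRF, p728771),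
`KolyvaginLowerBoundAtTwo.oppositeSignReciprocityAtTwo_of_frobeniusCongruence h37` (OSR mod P372, p724710),
`RegularWalk.signedRefillSupplyAtTwo` (SRS, p723829); and the statement is the DEFINITION `KolyvaginSwap.ShedSeedPrimeShapedAtTwo` of `…KolyvaginSwapDefs` (p736848: the v8.5
statement layer as defs, `OppShape` included), so the pen's proof goes through with `OppShape` FOLDED (the SC/SRF/START tree theorems,
stated with `OppShape` unfolded, feed it by definitional unfolding).  HONEST FRAMING: SWα⁗ is the hand of the pen's (unregistered, W-79)
v8.x re-cut; the line of record is the LEAD-registered v7.2r whose stub SWα `ShedSeedPrimeAtTwo` has a DIFFERENT statement — this file claims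
no stub credit.  It proves SWα⁗ CONDITIONALLY on Gross 1991 Prop. 3.7 (2) (`GrossLMS1991.prop37_2_frobeniusCongruence`, a named Literature
fact, unproved in the tree) and NOTHING about S0ʳ, U1 `KolyvaginBoundedDefectAtTwo`, a rung or BSD.  **BSD is NOT proved.**

## Statement (in words; the Lean text is the pen's, byte-for-byte up to the unfolding)
On U1's habitat, for `τ ≠ 1` and a sign `u = ±1`, there are functions `κ g : ℕ → ℕ` such that: for a square-free Kolyvagin conductor
`s·e` (seed part `s ≠ 1`, engine part `e` of regular primes of index `≥ I ≥ M+1`), margin one at level `M ≥ 1`, the `(−u)`-part of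
`H_{𝓕(e)}` of shape `Sh(t, a)`, not the corner `t = 0 ∧ #s = 1`, and the Kolyvagin class `c_M(se)` an exact `u`-eigenclass visible beyond
`2^{v + κ a}`, ONE seed prime `q ∣ s` can be traded for one engine prime `f`: `s = q s'`, the conductor `s'(ef)` is again square-free Kolyvagin
with margin one and the same number of prime factors, the new shape is `Sh(t', g a)` at `e f`, the new class `c_M(s' e f)` is exact of sign
`u`, and some datum at `(s' e f) q` compatible with it (GK2's four clauses) has `2^v · c_M((s'ef)q)` NOT Selmer-local at a place `w ∣ q`.
Consumed by `…KolyvaginSwapAssembly` (U1 ⟸ S0ʳ + P372).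

## Proof (the pen's walk of one step; card `line17/kolyvagin_swap_v7.md` §v8.1)
(0) `c = c_M(se)` visible beyond `2^{v+κa}` ⇒ `2c ≠ 0`, the level is large, the sign `u` is `−w(E)(−1)^{#(se)}` (tree sign law); (1) partner:
`t ≥ 1` ⇒ the basis class `g₀` (near-freeness), `t = 0` ⇒ `#s ≥ 2`, a seed prime `q₀ ∣ s` and SRS's exact `(−u)`-class
`z ∈ H_{𝓕(q₀e)}`; (2) ES: a deep regular engine prime `ℓ` killing the kept classes, cutting the partner, keeping `c` alive; (3) OSR names a
seed prime `q' ∣ s` with `2^v·loc_{q'} c_M(seℓ)` off the Selmer condition; (4) JET up/down data at `seℓ` and `s'(eℓ)`; (5) the new shape is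
SC's `Sh(t, gC(a+C_E))` or SRF's `Sh(1, gR a)`, weakened to `g a := max`.  `κ a = a + 2C_E + C_O + C_R + 2`.
References (locators only; no cited FACT is declared here): [cite: Kolyvagin1991StructureSha, Prop. 8]
[cite: MazurRubin2004, §4.1 Prop. 4.1.5, Lemma 4.1.7, Thm. 2.3.4] [cite: GrossLMS1991, §3 Prop. 3.7, §5, §9] [cite: McCallumLMS1991, §5].
Design: no definitions; `K : Type`; axioms `propext`, `Classical.choice`, `Quot.sound`.
-/

set_option autoImplicit false
-- the Theorems namespace of this sub repeats the summit name by design (D-0017 nested layout)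
set_option linter.dupNamespace false

noncomputable section

open scoped Classical
open WeierstrassCurve NumberField IsDedekindDomain Field
open Literature.NumberTheory.GaloisRepresentations Literature.NumberTheory.EllipticCurves
open Literature.NumberTheory
open Rat.HeightOneSpectrum
open Summit.BirchSwinnertonDyer.BirchSwinnertonDyer.Theorems
open Summit.BirchSwinnertonDyer.BirchSwinnertonDyer.Theses.KolyvaginRankRigidityAtTwo

namespace Summit.BirchSwinnertonDyer.BirchSwinnertonDyer.Theorems.KolyvaginAtTwo.KolyvaginSwap

/-! ### §2 SWα⁗ modulo P372 -/

/-- **SWα⁗ `ShedSeedPrimeShapedAtTwo` (pen v8.1–v8.5, the def of `…KolyvaginSwapDefs`), modulo P372.**  The pen's kernel composition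
`shedSeedPrimeShapedAtTwo_of` with ES/SC/SRF/SRS fed by the tree theorems and OSR by
`KolyvaginLowerBoundAtTwo.oppositeSignReciprocityAtTwo_of_frobeniusCongruence h37`; see the module docstring.
[cite: Kolyvagin1991StructureSha, Prop. 8] [cite: MazurRubin2004, §4.1 Prop. 4.1.5] [cite: GrossLMS1991, §3 Prop. 3.7 (2), §9] -/
theorem shedSeedPrimeShapedAtTwo_of_frobeniusCongruence
    (h37 : Literature.NumberTheory.EllipticCurves.GrossLMS1991.prop37_2_frobeniusCongruence) :
    ShedSeedPrimeShapedAtTwo := by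
  intro W _ _ hCM hred hsurj K _ _ hK _ hH hodd hd3 htors hH2 Dt β ι _ hβ τ hτ1 u hu
  obtain ⟨CE, hES⟩ := RegularWalk.engineSupplyAtTwo W hCM hred hsurj K hK hH hodd hd3 htors hH2 Dt β ι hβ τ hτ1 u hu
  obtain ⟨gC, hCut⟩ := RegularWalk.shapeCutAtTwo W hCM hred hsurj K hK hH hodd hd3 htors hH2 Dt β ι hβ τ hτ1 u hu
  obtain ⟨gR, hRef⟩ := RegularWalk.shapeRefillAtTwo W hCM hred hsurj K hK hH hodd hd3 htors hH2 Dt β ι hβ τ hτ1 u hu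
  obtain ⟨CO, hOSR⟩ := KolyvaginLowerBoundAtTwo.oppositeSignReciprocityAtTwo_of_frobeniusCongruence h37 W hCM hred hsurj K hK hH hodd hd3 htors hH2 Dt β ι hβ τ hτ1 u hu
  obtain ⟨CR, hSRS⟩ := RegularWalk.signedRefillSupplyAtTwo W hCM hred hsurj K hK hH hodd hd3 htors hH2 Dt β ι hβ τ hτ1 u hu
  refine ⟨fun a ↦ a + 2 * CE + CO + CR + 1 + 1, fun a ↦ max (gC (a + CE)) (gR a), ?_⟩
  intro a t I M v s e d hKol hs1 hM hMI hidx heng hshape hcorner hcsign hvis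
  obtain ⟨ρ, hρ, hvisρ⟩ := hvis
  beta_reduce at hvisρ
  -- (0) sizes, `2c ≠ 0`
  have hMbig : v + (a + 2 * CE + CO + CR + 1 + 1) < M := lt_level_of_vis hvisρ
  have h2c : (2 : ℤ) • d.kolyvaginClass Nat.prime_two M ≠ 0 :=
    two_zsmul_ne_zero_of_vis (x := v + (a + 2 * CE + CO + CR + 1)) hρ hvisρ
  have hn0 : s * e ≠ 0 := hKol.1.ne_zero
  have hs0 : s ≠ 0 := left_ne_zero_of_mul hn0
  have he0 : e ≠ 0 := right_ne_zero_of_mul hn0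
  have hsqs : Squarefree s := hKol.1.squarefree_of_dvd (dvd_mul_right s e)
  -- (0') the exact sign `u = −w(E)(−1)^#(se)`
  have hD4 : NumberField.discr K ≠ -4 := by
    intro h4
    rw [h4] at hodd
    exact (Int.not_even_iff_odd.mpr hodd) ⟨-2, by norm_num⟩
  have h21 : W.HasSurjectiveModNGaloisRep ((2 : ℤ) ^ 1) := by simpa using hsurj 1
  have hnK : ∀ q ∈ (s * e).primeFactors, Literature.NumberTheory.EllipticCurves.Zhang2014.IsKolyvaginPrime (W.conductorNorm ℤ) W K 2 q ∧
      M ≤ Literature.NumberTheory.EllipticCurves.Zhang2014.kolyvaginIndex W 2 q :=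
    fun q hq ↦ ⟨hKol.2 q hq, le_trans (Nat.le_succ M) (Zhang2014.natCast_le_levelIndex_iff.mp hidx q hq)⟩
  obtain ⟨hw', hcw'⟩ := GenusExact.KolyvaginClassSign.sign_conjAct_kolyvaginClass_two hK hd3 hD4 hodd hH h21 τ hτ1 Dt β ι hKol.1 hM hnK d
  generalize hwgen : (-W.rootNumber * (-1) ^ (s * e).primeFactors.card : ℤ) = w' at hw' hcw'
  have huw : u = w' := by
    rcases hu with rfl | rfl <;> rcases hw' with rfl | rfl
    · rfl
    · exfalso
      apply h2c
      rw [show (2 : ℤ) • d.kolyvaginClass Nat.prime_two M = (1 : ℤ) • d.kolyvaginClass Nat.prime_two M - (-1 : ℤ) • d.kolyvaginClass Nat.prime_two M by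
        rw [one_zsmul, neg_one_zsmul, sub_neg_eq_add, two_zsmul], ← hcsign, ← hcw', sub_self]
    · exfalso
      apply h2c
      rw [show (2 : ℤ) • d.kolyvaginClass Nat.prime_two M = (1 : ℤ) • d.kolyvaginClass Nat.prime_two M - (-1 : ℤ) • d.kolyvaginClass Nat.prime_two M by
        rw [one_zsmul, neg_one_zsmul, sub_neg_eq_add, two_zsmul], ← hcsign, ← hcw', sub_self]
    · rfl
  -- (0'') Gross's CM facts (PROVED Literature), `d_K < −4`, the UP data at every fresh Kolyvagin prime
  have hCM1 : phi_heegnerPointOfConductor_mem_range_map_ringClassField (W.conductorNorm ℤ) W K :=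
    phi_heegnerPointOfConductor_mem_range_map_ringClassField_holds (W.conductorNorm ℤ) W K
  have hD : NumberField.discr K < -4 := GenusKoly.discr_lt_neg_four_of_odd hK hodd hd3
  obtain ⟨dℓ, hdℓ⟩ := Summit.BirchSwinnertonDyer.Rank1Residual.JET.exists_compatible_data_of_grossCM hCM1 hK hD hH 2 Dt β ι hKol.1
    (fun l hl ↦ hKol.2 l hl) d
  -- (E) engine-prime bookkeeping
  have prep : ∀ ℓ : ℕ, Literature.NumberTheory.EllipticCurves.Zhang2014.IsKolyvaginPrime (W.conductorNorm ℤ) W K 2 ℓ → s * e < ℓ →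
      I ≤ Literature.NumberTheory.EllipticCurves.Zhang2014.kolyvaginIndex W 2 ℓ →
      ℓ.Prime ∧ ¬ ℓ ∣ e ∧ Literature.NumberTheory.EllipticCurves.KolyvaginDescent.KolSupp (Literature.NumberTheory.EllipticCurves.Zhang2014.IsKolyvaginPrime (W.conductorNorm ℤ) W K 2) (e * ℓ) ∧
        (((M + 1 : ℕ) : ℕ) : ℕ∞) ≤ Literature.NumberTheory.EllipticCurves.Zhang2014.levelIndex W 2 (e * ℓ) := by
    intro ℓ hKolℓ hlt hIℓ
    have hℓn : ¬ ℓ ∣ s * e := fun h ↦ absurd (Nat.le_of_dvd (Nat.pos_of_ne_zero hn0) h) (by omega)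
    have hℓe : ¬ ℓ ∣ e := fun h ↦ hℓn (dvd_mul_of_dvd_right h s)
    exact ⟨hKolℓ.1, hℓe, kolSupp_mul_of_prime (kolSupp_of_dvd hKol (dvd_mul_left e s)) hKolℓ.1 hKolℓ hℓe,
      levelIndex_mul_of_prime he0 hKolℓ.1 (levelIndex_of_dvd hn0 (dvd_mul_left e s) hidx) (le_trans hMI hIℓ)⟩
  -- (T) THE COMMON TAIL: OSR names the seed prime; JET UP/DOWN; bookkeeping; hand over the new shape.
  have tail : ∀ (m₁ t' aE bO ℓ : ℕ) (z : galH1Torsion (W.baseChange K) ((2 ^ M : ℕ) : ℤ))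
      (w : IsDedekindDomain.HeightOneSpectrum (NumberField.RingOfIntegers K)),
      m₁ ∣ s → z ∈ Jetchev2008.modifiedSelmerGroup W K ι ((2 ^ M : ℕ) : ℤ) (m₁ * e) →
      conjAct W τ ((2 ^ M : ℕ) : ℤ) z = (-u) • z →
      Literature.NumberTheory.EllipticCurves.Zhang2014.IsKolyvaginPrime (W.conductorNorm ℤ) W K 2 ℓ → s * e < ℓ →
      I ≤ Literature.NumberTheory.EllipticCurves.Zhang2014.kolyvaginIndex W 2 ℓ →
      (∃ (pl : HeightOneSpectrum (𝓞 ℚ)) (𝔓 : Ideal (absIntegers (𝓞 ℚ) ℚ)) (h : absoluteGaloisGroup ℚ), (ℓ : 𝓞 ℚ) ∈ pl.asIdeal ∧ 𝔓 ∈ pl.primesAbove ∧ IsArithFrobAt (𝓞 ℚ) h 𝔓 ∧ (∀ X : geomTorsion W ((2 ^ M : ℕ) : ℤ), h • h • X = X) ∧ ∃ P : geomTorsion W ((2 ^ M : ℕ) : ℤ), (2 : ℤ) ^ (M - 1) • (P + h • P) ≠ 0) →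
      (ℓ : NumberField.RingOfIntegers K) ∈ w.asIdeal →
      ((2 ^ aE : ℕ) : ℤ) • z ∉ (W.baseChange K).torsionLocalKer (w.adicCompletion K) ((2 ^ M : ℕ) : ℤ) →
      ((2 ^ bO : ℕ) : ℤ) • d.kolyvaginClass Nat.prime_two M ∉ (W.baseChange K).torsionLocalKer (w.adicCompletion K) ((2 ^ M : ℕ) : ℤ) →
      v + M + CO ≤ aE + bO →
      OppShape W K ι τ M (e * ℓ) u (max (gC (a + CE)) (gR a)) t' →
        ∃ (q s' f t' : ℕ) (d' : Literature.NumberTheory.EllipticCurves.KolyvaginHeegnerData Dt β ι (s' * (e * f))),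
          s = q * s' ∧ q.Prime ∧
          (∀ p ∈ (e * f).primeFactors, I ≤ Literature.NumberTheory.EllipticCurves.Zhang2014.kolyvaginIndex W 2 p ∧ (∃ (pl : HeightOneSpectrum (𝓞 ℚ)) (𝔓 : Ideal (absIntegers (𝓞 ℚ) ℚ)) (h : absoluteGaloisGroup ℚ), (p : 𝓞 ℚ) ∈ pl.asIdeal ∧ 𝔓 ∈ pl.primesAbove ∧ IsArithFrobAt (𝓞 ℚ) h 𝔓 ∧ (∀ X : geomTorsion W ((2 ^ M : ℕ) : ℤ), h • h • X = X) ∧ ∃ P : geomTorsion W ((2 ^ M : ℕ) : ℤ), (2 : ℤ) ^ (M - 1) • (P + h • P) ≠ 0)) ∧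
          s'.primeFactors.card + 1 = s.primeFactors.card ∧
          (s' * (e * f)).primeFactors.card = (s * e).primeFactors.card ∧
          Literature.NumberTheory.EllipticCurves.KolyvaginDescent.KolSupp (Literature.NumberTheory.EllipticCurves.Zhang2014.IsKolyvaginPrime (W.conductorNorm ℤ) W K 2) (s' * (e * f)) ∧
          (((M + 1 : ℕ) : ℕ) : ℕ∞) ≤ Literature.NumberTheory.EllipticCurves.Zhang2014.levelIndex W 2 (s' * (e * f)) ∧
          OppShape W K ι τ M (e * f) u (max (gC (a + CE)) (gR a)) t' ∧
          conjAct W τ ((2 ^ M : ℕ) : ℤ) (d'.kolyvaginClass Nat.prime_two M) = u • d'.kolyvaginClass Nat.prime_two M ∧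
          ∃ dup : Literature.NumberTheory.EllipticCurves.KolyvaginHeegnerData Dt β ι (s' * (e * f) * q),
          Squarefree (s' * (e * f) * q) ∧ ¬ q ∣ s' * (e * f) ∧
          (∀ l' ∈ (s' * (e * f) * q).primeFactors, Literature.NumberTheory.EllipticCurves.Zhang2014.IsKolyvaginPrime (W.conductorNorm ℤ) W K 2 l' ∧ M ≤ Literature.NumberTheory.EllipticCurves.Zhang2014.kolyvaginIndex W 2 l') ∧
          (∀ l' ∈ (s' * (e * f)).primeFactors, ∀ (x : Literature.NumberTheory.EllipticCurves.ringClassField K ι (s' * (e * f))) (x' : Literature.NumberTheory.EllipticCurves.ringClassField K ι (s' * (e * f) * q)), (x : ℂ) = x' → ((dup.σ l' x' : Literature.NumberTheory.EllipticCurves.ringClassField K ι (s' * (e * f) * q)) : ℂ) = (d'.σ l' x : ℂ)) ∧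
          (∀ t ∈ d'.S, ∃ t' ∈ dup.S, ∀ (x : Literature.NumberTheory.EllipticCurves.ringClassField K ι (s' * (e * f))) (x' : Literature.NumberTheory.EllipticCurves.ringClassField K ι (s' * (e * f) * q)), (x : ℂ) = x' → ((t' x' : Literature.NumberTheory.EllipticCurves.ringClassField K ι (s' * (e * f) * q)) : ℂ) = (t x : ℂ)) ∧
          (∀ t' ∈ dup.S, ∃ t ∈ d'.S, ∀ (x : Literature.NumberTheory.EllipticCurves.ringClassField K ι (s' * (e * f))) (x' : Literature.NumberTheory.EllipticCurves.ringClassField K ι (s' * (e * f) * q)), (x : ℂ) = x' → ((t' x' : Literature.NumberTheory.EllipticCurves.ringClassField K ι (s' * (e * f) * q)) : ℂ) = (t x : ℂ)) ∧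
          (∀ (x : Literature.NumberTheory.EllipticCurves.ringClassField K ι (s' * (e * f))) (x' : Literature.NumberTheory.EllipticCurves.ringClassField K ι (s' * (e * f) * q)), (x : ℂ) = x' → dup.emb x' = d'.emb x) ∧
          ∃ w : IsDedekindDomain.HeightOneSpectrum (NumberField.RingOfIntegers K), (q : NumberField.RingOfIntegers K) ∈ w.asIdeal ∧
            ((2 ^ v : ℕ) : ℤ) • dup.kolyvaginClass Nat.prime_two M ∉ WeierstrassCurve.selmerLocalKer (W.baseChange K) (w.adicCompletion K) ((2 ^ M : ℕ) : ℤ) := by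
    intro m₁ t' aE bO ℓ z w hm₁ hzmem hzsign hKolℓ hlt hIℓ hreg hw hzloc hcloc hroom hshape'
    obtain ⟨hℓprime, hℓe, hKoleℓ, hidxeℓ⟩ := prep ℓ hKolℓ hlt hIℓ
    have hℓn : ¬ ℓ ∣ s * e := fun h ↦ absurd (Nat.le_of_dvd (Nat.pos_of_ne_zero hn0) h) (by omega)
    have hℓS : ℓ ∉ (s * e).primeFactors := fun h ↦ hℓn (Nat.dvd_of_mem_primeFactors h)
    have hIℓM : M + 1 ≤ Literature.NumberTheory.EllipticCurves.Zhang2014.kolyvaginIndex W 2 ℓ := le_trans hMI hIℓ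
    have hmdvd : m₁ * e ∣ s * e := Nat.mul_dvd_mul_right hm₁ e
    obtain ⟨hσ, hS, hS', hemb⟩ := hdℓ ℓ hKolℓ hℓS
    -- OSR
    obtain ⟨q', hq'mem, w₂, hw₂, hnotSel⟩ := hOSR M (m₁ * e) (s * e) ℓ aE bO v d z hKol hM hidx hmdvd hzmem hzsign hcsign hKolℓ hℓn hIℓM
      w hw hzloc hcloc hroom (dℓ ℓ hKolℓ hℓS) hσ hS hS' hemb
    -- `q'` is a SEED prime
    have hdiv : s * e / (m₁ * e) = s / m₁ := by
      obtain ⟨k, rfl⟩ := hm₁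
      have hm₁0 : 0 < m₁ := Nat.pos_of_ne_zero (left_ne_zero_of_mul hs0)
      rw [show m₁ * k * e = m₁ * e * k by ring, Nat.mul_div_cancel_left k (Nat.mul_pos hm₁0 (Nat.pos_of_ne_zero he0)),
        Nat.mul_div_cancel_left k hm₁0]
    rw [hdiv] at hq'mem
    have hq's : q' ∈ s.primeFactors := Nat.primeFactors_mono (Nat.div_dvd_of_dvd hm₁) hs0 hq'mem
    have hq' : q'.Prime := Nat.prime_of_mem_primeFactors hq's
    have hq'dvd : q' ∣ s := Nat.dvd_of_mem_primeFactors hq's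
    obtain ⟨s', hsq⟩ : ∃ s' : ℕ, s = q' * s' := ⟨s / q', (Nat.mul_div_cancel' hq'dvd).symm⟩
    have hs'0 : s' ≠ 0 := fun h ↦ hs0 (by rw [hsq, h, mul_zero])
    have hq's' : ¬ q' ∣ s' := fun h ↦ hq'.ne_one (Nat.isUnit_iff.mp (hsqs q' (by rw [hsq]; exact Nat.mul_dvd_mul_left q' h)))
    have hN : s * e * ℓ = s' * (e * ℓ) * q' := by rw [hsq]; ring
    have hdvdN : s' * (e * ℓ) ∣ s * e * ℓ := ⟨q', hN⟩
    have hKolN : Literature.NumberTheory.EllipticCurves.KolyvaginDescent.KolSupp (Literature.NumberTheory.EllipticCurves.Zhang2014.IsKolyvaginPrime (W.conductorNorm ℤ) W K 2) (s * e * ℓ) := kolSupp_mul_of_prime hKol hℓprime hKolℓ hℓn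
    have hKol' : Literature.NumberTheory.EllipticCurves.KolyvaginDescent.KolSupp (Literature.NumberTheory.EllipticCurves.Zhang2014.IsKolyvaginPrime (W.conductorNorm ℤ) W K 2) (s' * (e * ℓ)) := kolSupp_of_dvd hKolN hdvdN
    have hidxN : (((M + 1 : ℕ) : ℕ) : ℕ∞) ≤ Literature.NumberTheory.EllipticCurves.Zhang2014.levelIndex W 2 (s * e * ℓ) :=
      levelIndex_mul_of_prime hn0 hℓprime hidx hIℓM
    have hidx' : (((M + 1 : ℕ) : ℕ) : ℕ∞) ≤ Literature.NumberTheory.EllipticCurves.Zhang2014.levelIndex W 2 (s' * (e * ℓ)) :=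
      levelIndex_of_dvd hKolN.1.ne_zero hdvdN hidxN
    -- JET DOWN: the datum at `s'(eℓ)` compatible with the UP datum at `seℓ`
    obtain ⟨d', hσ', hT', hT'', hemb'⟩ :=
      Summit.BirchSwinnertonDyer.Rank1Residual.JET.exists_compatible_datum_of_dvd_of_grossCM hK hD hH 2 Dt β ι hKolN.1
        (fun l hl ↦ hKolN.2 l hl) hdvdN (dℓ ℓ hKolℓ hℓS)
    -- cardinalities
    have hse'0 : s' * e ≠ 0 := mul_ne_zero hs'0 he0
    have hℓse' : ¬ ℓ ∣ s' * e := fun h ↦ hℓn (dvd_trans h ⟨q', by rw [hsq]; ring⟩)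
    have hq'se' : ¬ q' ∣ s' * e := fun h ↦ hq'.ne_one (Nat.isUnit_iff.mp (hKol.1 q' (by
      rw [show s * e = q' * (s' * e) by rw [hsq, mul_assoc]]
      exact Nat.mul_dvd_mul_left q' h)))
    have hcard' : s'.primeFactors.card + 1 = s.primeFactors.card := by
      rw [hsq, mul_comm, KolyvaginAtTwo.RegularWalk.card_primeFactors_mul_of_not_dvd hs'0 hq' hq's']
    have hcardn : (s' * (e * ℓ)).primeFactors.card = (s * e).primeFactors.card := by
      rw [show s' * (e * ℓ) = s' * e * ℓ by ring, KolyvaginAtTwo.RegularWalk.card_primeFactors_mul_of_not_dvd hse'0 hℓprime hℓse',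
        show s * e = s' * e * q' by rw [hsq]; ring, KolyvaginAtTwo.RegularWalk.card_primeFactors_mul_of_not_dvd hse'0 hq' hq'se']
    -- the engine clause at `eℓ`
    have hdeepf : ∀ p ∈ (e * ℓ).primeFactors, I ≤ Literature.NumberTheory.EllipticCurves.Zhang2014.kolyvaginIndex W 2 p ∧ (∃ (pl : HeightOneSpectrum (𝓞 ℚ)) (𝔓 : Ideal (absIntegers (𝓞 ℚ) ℚ)) (h : absoluteGaloisGroup ℚ), (p : 𝓞 ℚ) ∈ pl.asIdeal ∧ 𝔓 ∈ pl.primesAbove ∧ IsArithFrobAt (𝓞 ℚ) h 𝔓 ∧ (∀ X : geomTorsion W ((2 ^ M : ℕ) : ℤ), h • h • X = X) ∧ ∃ P : geomTorsion W ((2 ^ M : ℕ) : ℤ), (2 : ℤ) ^ (M - 1) • (P + h • P) ≠ 0) := by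
      intro p hp
      rw [Nat.primeFactors_mul he0 hℓprime.ne_zero, hℓprime.primeFactors, Finset.mem_union, Finset.mem_singleton] at hp
      rcases hp with hp | rfl
      · exact heng p hp
      · exact ⟨hIℓ, hreg⟩
    -- the sign of `c_M(s'(eℓ))`
    have hnK' : ∀ q ∈ (s' * (e * ℓ)).primeFactors, Literature.NumberTheory.EllipticCurves.Zhang2014.IsKolyvaginPrime (W.conductorNorm ℤ) W K 2 q ∧
        M ≤ Literature.NumberTheory.EllipticCurves.Zhang2014.kolyvaginIndex W 2 q :=
      fun q hq ↦ ⟨hKol'.2 q hq, le_trans (Nat.le_succ M) (Zhang2014.natCast_le_levelIndex_iff.mp hidx' q hq)⟩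
    obtain ⟨-, hc'⟩ := GenusExact.KolyvaginClassSign.sign_conjAct_kolyvaginClass_two hK hd3 hD4 hodd hH h21 τ hτ1 Dt β ι hKol'.1 hM hnK' d'
    rw [hcardn, hwgen, ← huw] at hc'
    -- all factors of `seℓ` are Kolyvagin with margin
    have hallN : ∀ l' ∈ (s * e * ℓ).primeFactors, Literature.NumberTheory.EllipticCurves.Zhang2014.IsKolyvaginPrime (W.conductorNorm ℤ) W K 2 l' ∧
        M ≤ Literature.NumberTheory.EllipticCurves.Zhang2014.kolyvaginIndex W 2 l' :=
      fun q hq ↦ ⟨hKolN.2 q hq, le_trans (Nat.le_succ M) (Zhang2014.natCast_le_levelIndex_iff.mp hidxN q hq)⟩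
    have hq'N : ¬ q' ∣ s' * (e * ℓ) := fun h ↦ hq'.ne_one (Nat.isUnit_iff.mp (hKolN.1 q' (by
      rw [hN]
      exact Nat.mul_dvd_mul_right h q')))
    refine ⟨q', s', ℓ, t', d', hsq, hq', hdeepf, hcard', hcardn, hKol', hidx', hshape', hc', ?_⟩
    -- the UP datum transported to the literal conductor `s' * (e * ℓ) * q'`
    generalize hX : s' * (e * ℓ) * q' = X
    have hXN : X = s * e * ℓ := by rw [← hX, hN]
    subst hXN
    exact ⟨dℓ ℓ hKolℓ hℓS, hKolN.1, hq'N, hallN, hσ', hT', hT'', hemb', w₂, hw₂, hnotSel⟩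
  -- (S) THE TWO CASES OF THE SHAPE
  obtain ⟨g, hgmem, hgsign, hgfree, hgspan⟩ := id hshape
  cases t with
  | succ t =>
    -- CUT `g 0`: ES's span hypothesis from near-freeness at error `a`
    have hspanES : ∀ bv : Fin t → ℤ, ¬ ∀ σ ∈ torsionFixing (W.baseChange K) ((2 ^ (M + 1) : ℕ) : ℤ),
        h1Eval (W.baseChange K) ((2 ^ M : ℕ) : ℤ) (((2 ^ (M - (a + CE) - 1 + CE) : ℕ) : ℤ) • g 0 - ∑ i, bv i • g i.succ) σ = 0 := by
      intro bv hall
      have hsum : ∑ i : Fin (t + 1), (Fin.cons (((2 ^ (M - (a + CE) - 1 + CE) : ℕ) : ℤ)) (fun i ↦ -bv i) : Fin (t + 1) → ℤ) i • g i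
          = (((2 ^ (M - (a + CE) - 1 + CE) : ℕ) : ℤ)) • g 0 - ∑ i : Fin t, bv i • g i.succ := by
        rw [Fin.sum_univ_succ, Fin.cons_zero, sub_eq_add_neg, ← Finset.sum_neg_distrib]
        congr 1
        refine Finset.sum_congr rfl fun i _ ↦ ?_
        rw [Fin.cons_succ, neg_zsmul]
      have key := hgfree (Fin.cons (((2 ^ (M - (a + CE) - 1 + CE) : ℕ) : ℤ)) (fun i ↦ -bv i)) (fun σ hσ ↦ by rw [hsum]; exact hall σ hσ) 0
      rw [Fin.cons_zero] at key
      have key' : 2 ^ (M - a) ∣ 2 ^ (M - (a + CE) - 1 + CE) := by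
        have h2 : ((2 : ℤ) ^ (M - a)) = ((2 ^ (M - a) : ℕ) : ℤ) := by push_cast; rfl
        rw [h2] at key
        exact Int.natCast_dvd_natCast.mp key
      have := (Nat.pow_dvd_pow_iff_le_right (by norm_num : 1 < 2)).mp key'
      omega
    have hvisE : ∃ ρ ∈ torsionFixing (W.baseChange K) ((2 ^ M : ℕ) : ℤ),
        ((2 ^ ((v + CO + a + CE + 1) + CE) : ℕ) : ℤ) • h1Eval (W.baseChange K) ((2 ^ M : ℕ) : ℤ) (d.kolyvaginClass Nat.prime_two M) ρ ≠ 0 :=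
      ⟨ρ, hρ, KolyvaginLowerBoundAtTwo.two_pow_zsmul_ne_zero_of_le_swap (by omega) hvisρ⟩
    obtain ⟨ℓ, hlt, hKolℓ, ⟨hIℓ, hreg⟩, w, hw, hyloc, hzloc, hcloc⟩ :=
      hES M I (s * e) t (M - (a + CE) - 1) (v + CO + a + CE + 1) (fun i ↦ g i.succ) (g 0) (d.kolyvaginClass Nat.prime_two M)
        hM hMI (fun i ↦ hgsign i.succ) (hgsign 0) hcsign hspanES hvisE
    obtain ⟨hℓprime, hℓe, hKoleℓ, hidxeℓ⟩ := prep ℓ hKolℓ hlt hIℓ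
    -- SC at error `a + C_E`
    have shape' : OppShape W K ι τ M (e * ℓ) u (gC (a + CE)) t :=
      hCut M e ℓ (a + CE) t g hKoleℓ hℓprime hℓe hM hidxeℓ hgmem hgsign (free_mono (Nat.le_add_right a CE) hgfree)
        (span_mono (Nat.le_add_right a CE) hgspan) ⟨w, hw, hyloc, hzloc⟩
    exact tail 1 t (M - (a + CE) - 1) (v + CO + a + CE + 1) ℓ (g 0) w (one_dvd s) (by rw [one_mul]; exact hgmem 0) (hgsign 0)
      hKolℓ hlt hIℓ hreg hw hzloc hcloc (by omega) (oppShape_mono (le_max_left _ _) shape')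
  | zero =>
    -- REFILL: the corner gives a second seed prime `q₀`; SRS supplies the partner in `H_(𝓕(q₀e))`
    have h2s : 2 ≤ s.primeFactors.card := by
      rcases hcorner with h | h
      · omega
      · exact h
    obtain ⟨q₀, hq₀⟩ : s.primeFactors.Nonempty := Finset.card_pos.mp (by omega)
    have hq₀p : q₀.Prime := Nat.prime_of_mem_primeFactors hq₀
    have hq₀s : q₀ ∣ s := Nat.dvd_of_mem_primeFactors hq₀
    have hq₀e : ¬ q₀ ∣ e := fun h ↦ hq₀p.ne_one (Nat.isUnit_iff.mp (hKol.1 q₀ (mul_dvd_mul hq₀s h)))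
    have hKolq : Literature.NumberTheory.EllipticCurves.KolyvaginDescent.KolSupp (Literature.NumberTheory.EllipticCurves.Zhang2014.IsKolyvaginPrime (W.conductorNorm ℤ) W K 2) (q₀ * e) := kolSupp_of_dvd hKol (Nat.mul_dvd_mul_right hq₀s e)
    have hidxq : (((M + 1 : ℕ) : ℕ) : ℕ∞) ≤ Literature.NumberTheory.EllipticCurves.Zhang2014.levelIndex W 2 (q₀ * e) :=
      levelIndex_of_dvd hn0 (Nat.mul_dvd_mul_right hq₀s e) hidx
    obtain ⟨z, hzmem, hzsign, hzne⟩ := hSRS a M q₀ e hKolq hq₀p hq₀e hM hidxq hshape (by omega)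
    have hvisE : ∃ ρ ∈ torsionFixing (W.baseChange K) ((2 ^ M : ℕ) : ℤ),
        ((2 ^ ((v + CO + a + CR + CE + 2) + CE) : ℕ) : ℤ) • h1Eval (W.baseChange K) ((2 ^ M : ℕ) : ℤ) (d.kolyvaginClass Nat.prime_two M) ρ ≠ 0 :=
      ⟨ρ, hρ, KolyvaginLowerBoundAtTwo.two_pow_zsmul_ne_zero_of_le_swap (by omega) hvisρ⟩
    have hES0 := hES M I (s * e) 0 (M - (a + CR + CE + 1) - 1) (v + CO + a + CR + CE + 2) (fun i ↦ Fin.elim0 i) z (d.kolyvaginClass Nat.prime_two M)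
      hM hMI (fun i ↦ Fin.elim0 i) hzsign hcsign
    obtain ⟨ℓ, hlt, hKolℓ, ⟨hIℓ, hreg⟩, w, hw, -, hzloc, hcloc⟩ := hES0 (by
      intro bv hall
      apply hzne
      have hres : ∀ σ ∈ torsionFixing (W.baseChange K) ((2 ^ (M + 1) : ℕ) : ℤ),
          h1Eval (W.baseChange K) ((2 ^ M : ℕ) : ℤ) ((((2 ^ (M - (a + CR + CE + 1) - 1 + CE) : ℕ) : ℤ)) • z) σ = 0 := by
        intro σ hσ
        have h := hall σ hσ
        rwa [Fin.sum_univ_zero, sub_zero] at h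
      have h2z := KolyvaginAtTwo.RegularWalk.two_zsmul_eq_zero_of_res_eq_zero W hK (hsurj (M + 1)) hres
      have hpow : ((2 ^ (M - (a + CR + CE + 1) - 1 + CE + 1) : ℕ) : ℤ) • z = 0 := by
        rw [show ((2 ^ (M - (a + CR + CE + 1) - 1 + CE + 1) : ℕ) : ℤ) = 2 * ((2 ^ (M - (a + CR + CE + 1) - 1 + CE) : ℕ) : ℤ) by
          push_cast; ring, mul_zsmul]
        exact h2z
      exact KolyvaginLowerBoundAtTwo.two_pow_zsmul_eq_zero_of_le_swap (by omega) hpow) hvisE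
    obtain ⟨hℓprime, hℓe, hKoleℓ, hidxeℓ⟩ := prep ℓ hKolℓ hlt hIℓ
    -- SRF
    have shape' : OppShape W K ι τ M (e * ℓ) u (gR a) 1 := hRef M e ℓ a hKoleℓ hℓprime hℓe hM hidxeℓ hshape
    exact tail q₀ 1 (M - (a + CR + CE + 1) - 1) (v + CO + a + CR + CE + 2) ℓ z w hq₀s hzmem hzsign
      hKolℓ hlt hIℓ hreg hw hzloc hcloc (by omega) (oppShape_mono (le_max_right _ _) shape')

end Summit.BirchSwinnertonDyer.BirchSwinnertonDyer.Theorems.KolyvaginAtTwo.KolyvaginSwap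

end
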